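import Mathlib
import HarnessLib
import Summits.HubbardSuperconductivity.HubbardSuperconductivity.Theorems.KLProgrammeC4aEnvelopeLayerCake

/-!
# Route `KLProgramme` — crux C4a, S3 brick (B4)/(B5) «(B4)-ABS-BUBBLE», part 3: the COOPER configuration and the LEVEL LAYERS — the loop-angle bound
# near Cooper costs one logarithm of the distance to the Cooper point, and integrating the loop-angle bounds against the finer line's level is `n`-free

Cell `gate-hubbard-kl`, seat hubbard-kl-k3c3-p3 (g26; row «implicit-function / monotonicity route for μ(n)»).  Located brick for the (C)-closer lane
hubbard-kl-c4a-1 (stub (C) `stub_twoLeg_curvature` of `KLRegimeEngineV17F2`, stmt-HubbardSuperconductivity-20437), C4A-PLAN §24.4–§24.6 (B4)/(B5),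
HOME/hubbard-kl-k3c3-p3/B4-DIRECT-COUNT.md §2 and B4-ABS-BUBBLE.md.  Sequel of `…C4aSublevelCounting` (distribution function) and `…C4aEnvelopeLayerCake`
(`∫ dφ/max(t,|ē|) ≤ 2(b−a)/κ + (2N/c₁)·log⁺(κ/(2t))` `[+ 12N/√(c₂t)]`).

* §4 COOPER.  `integral_inv_envelope_le_trivial`: `∫_{[a,b]} dx/max(t,|g|) ≤ (b − a)/t`.  **`integral_inv_envelope_le_cooper`**: near the Cooper
  configuration the partner band is `g = e + r·Ĝ` (`r ≍ ‖ϑ − π‖_𝕋 + |ρ|`, exact nesting `ē ≡ e` at `r = 0`, `…C4aPartnerBandCritical`) with a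
  NON-DEGENERATE profile (`|Ĝ| ≤ ĉ₀ → ĉ₁ ≤ |Ĝ′|`: the zeros of `n(p)·D̂` are transversal by the curvature floor — `…C4aTransversalityGaussLaw`, the Cooper
  branch of `…C4aLoopNondegeneracy`), i.e. the SCALED dichotomy `|g − e| ≤ ĉ₀r → ĉ₁r ≤ |g′|` with ceiling `|g′| ≤ L̂₁r`; then for the small levels
  `|e| ≤ ĉ₀r/2`: `∫ dx/max(t,|g|) ≤ (4(b − a)/ĉ₀ + (2N/ĉ₁)·log⁺(ĉ₀r/(4t)))/r` (`N` cells, `(b − a)·4L̂₁ ≤ N·ĉ₀`, `r`-FREE).  For the large levels the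
  trivial bound `(b − a)/t ≤ 2(b − a)/(ĉ₀r)` (`t ≥ |e|`) is already of the same size: NO second-order (Morse) structure of the Cooper profile is needed.
  `integral_inv_envelope_le_cooper_of_le`: the same keyed on any base scale `η ≤ r` (the closer may key the Cooper window on `η = ‖ϑ − π‖_𝕋` alone).
* §5 LEVEL LAYERS (the finer line's level `e ∈ [lo, hi]`, `lo = Λ_n/2`-type infrared end, `hi = E₀`; weight `0 ≤ w ≤ W`).
  `intervalIntegral_posLog_div_le`: `∫_{lo..hi} log⁺(κ/e) de ≤ (hi − lo)(1 + log⁺(κ/hi))` (Mathlib `integral_log`).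
  **`intervalIntegral_level_layer_le`** (transversal + fold classes): `0 ≤ I e ≤ A + B·log⁺(κ/e) + C/√e` on `[lo,hi]` ⟹
  `∫_{lo..hi} w·I ≤ W·((A + B(1 + log⁺(κ/hi)))(hi − lo) + 2C√hi)` — NO `lo`-dependence: the absolute bubble is `n`-free.
  **`intervalIntegral_level_layer_cooper_le`**: `I e ≤ Q + R·log⁺(θ₀/(2e))` for `e ≤ θ₀` (`θ₀ = ĉ₀η/2`; `Q, R ∝ 1/η` from §4) and `I e ≤ P/e` for `e > θ₀`
  (trivial bound) ⟹ `∫_{lo..hi} w·I ≤ W·((Q + 2R)θ₀ + P·log⁺(hi/θ₀))` — with `Qθ₀ = 2(b − a)`, `Rθ₀ = Nĉ₀/ĉ₁` this is `η`-free but for ONE LOGARITHM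
  `log⁺(2hi/(ĉ₀η))`, integrable over the Cooper window in `ϑ` by `intervalIntegral_posLog_div_le` again (`∫₀^δ log⁺(M/η) dη ≤ δ(1 + log⁺(M/δ))`):
  the BCS logarithm lives only AT the Cooper point, and `sup_{ρ,θ} ∫dϑ |𝐁|_abs` is `n`-free (B4-DIRECT-COUNT.md §2).

Carrier-free (`g, w, I : ℝ → ℝ`); the geometric rows (dichotomy constants per configuration class) are the closer's inputs, listed in B4-ABS-BUBBLE.md §3.
Nothing about the Hubbard model's sizes; nothing asserts (C), K3 or superconductivity.  References: Salmhofer, Renormalization (1999) §4.5.3 Lemma 4.10 /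
Cor. 4.11 (`B_t(q) ≤ 2B₀²Q_O(2 + log(ε₀/‖q‖²))`: «the only place where B(q) can diverge as β → ∞ is q = 0»), App. B.8.1 [cite: Salmhofer1999]; FST II,
CPAM 51 (1998) §3 [cite: FeldmanSalmhoferTrubowitz1998]; BGM 2006 §2.4, App. A2 [cite: BenfattoGiulianiMastropietro2006].
-/

noncomputable section

namespace Summit.HubbardSuperconductivity.HubbardSuperconductivity.Theorems.C4a

set_option linter.dupNamespace false -- summit = problem name (single-conjunct summit), D-0017

open Real Set Filter MeasureTheory intervalIntegral
open scoped Topology ENNReal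

/-! ## §4 The trivial bound and the COOPER configuration -/

section Cooper

variable {g : ℝ → ℝ} {a b : ℝ}

/-- **TRIVIAL BOUND**: `∫_{[a,b]} dx/max(t,|g x|) ≤ (b − a)/t` (`t > 0`). -/
theorem integral_inv_envelope_le_trivial (hab : a ≤ b) (g : ℝ → ℝ) {t : ℝ} (ht : 0 < t) :
    ∫ x in Icc a b, (max t |g x|)⁻¹ ≤ (b - a) / t := by
  have h : ∫ x in Icc a b, (max t |g x|)⁻¹ ≤ ∫ x in Icc a b, t⁻¹ := by
    refine integral_mono_of_nonneg (Eventually.of_forall fun x => inv_envelope_nonneg g ht x) ?_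
      (Eventually.of_forall fun x => inv_envelope_le g ht x)
    exact integrableOn_const (by rw [Real.volume_Icc]; exact ENNReal.ofReal_ne_top)
  refine h.trans (le_of_eq ?_)
  rw [setIntegral_const, Real.volume_real_Icc_of_le hab, smul_eq_mul, div_eq_mul_inv]

/-- **THE COOPER CONFIGURATION, SMALL LEVELS.**  Near the Cooper configuration the partner band is `g = e + r·Ĝ` with `r ≍ ‖ϑ − π‖ + |ρ|` and a
NON-DEGENERATE profile `Ĝ` (`|Ĝ| ≤ ĉ₀ → ĉ₁ ≤ |Ĝ′|`: the Gauss map of the strictly convex Fermi curve, `…C4aTransversalityGaussLaw` /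
`…C4aLoopNondegeneracy`), i.e. the SCALED first-order dichotomy `|g x − e| ≤ ĉ₀r → ĉ₁r ≤ |g′ x|` with the scaled ceiling `|g′| ≤ L̂₁r`.  For the small
levels `|e| ≤ ĉ₀r/2` and any `t > 0`:
`∫_{[a,b]} dx/max(t,|g x|) ≤ (4(b − a)/ĉ₀ + (2N/ĉ₁)·log⁺(ĉ₀r/(4t)))/r`, `N` cells with `(b − a)·4L̂₁ ≤ N·ĉ₀` (r-FREE) — part 2's first-order
bound with `κ = ĉ₀r/2`.  (For the large levels `|e| > ĉ₀r/2` the trivial bound `(b − a)/t ≤ 2(b − a)/(ĉ₀r)` is already of the same size, since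
`t ≥ |e|` after the finer-line split: NO second-order structure of the Cooper profile is needed.) [cite: FeldmanSalmhoferTrubowitz1998, §3] -/
theorem integral_inv_envelope_le_cooper (hab : a ≤ b) (hg : ContDiff ℝ 1 g) {e r c₀ c₁ L₁ t : ℝ} {N : ℕ} (hr : 0 < r) (hc₀ : 0 < c₀)
    (hc₁ : 0 < c₁) (hL₁ : 0 < L₁) (hL : ∀ x ∈ Icc a b, |deriv g x| ≤ L₁ * r)
    (hdich : ∀ x ∈ Icc a b, |g x - e| ≤ c₀ * r → c₁ * r ≤ |deriv g x|) (hN : (b - a) * (4 * L₁) ≤ N * c₀)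
    (he : |e| ≤ c₀ * r / 2) (ht : 0 < t) :
    ∫ x in Icc a b, (max t |g x|)⁻¹ ≤ (4 * (b - a) / c₀ + N * (2 / c₁) * log⁺ (c₀ * r / (4 * t))) / r := by
  have hκ : 0 < c₀ * r / 2 := by positivity
  have hdich' : ∀ x ∈ Icc a b, |g x| ≤ c₀ * r / 2 → c₁ * r ≤ |deriv g x| := fun x hx hgx => by
    refine hdich x hx ?_
    calc |g x - e| ≤ |g x| + |e| := abs_sub _ _
      _ ≤ c₀ * r / 2 + c₀ * r / 2 := add_le_add hgx he
      _ = c₀ * r := by ring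
  have hN' : (b - a) * (2 * (L₁ * r)) ≤ N * (c₀ * r / 2) := by
    have := mul_le_mul_of_nonneg_right hN hr.le
    nlinarith
  have h := integral_inv_envelope_le_of_dichotomy_one hab hg hκ (by positivity : 0 < c₁ * r) (by positivity : 0 < L₁ * r) hL hdich' hN' ht
  refine h.trans (le_of_eq ?_)
  have e1 : c₀ * r / 2 / (2 * t) = c₀ * r / (4 * t) := by ring
  rw [e1]
  field_simp
  ring

/-- The Cooper bound with the BASE scale `η ≤ r` in place of `r`: if the dichotomy holds at scale `r`, the bound at any smaller scale `η` follows for the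
levels `|e| ≤ ĉ₀η/2` (`{|g − e| ≤ ĉ₀η} ⊆ {|g − e| ≤ ĉ₀r}` and `ĉ₁r ≥ ĉ₁η`) — so the closer may always key the Cooper window on `η = ‖ϑ − π‖_𝕋` even when the
true distance to the Cooper configuration (`≍ η + |ρ|`) is larger. -/
theorem integral_inv_envelope_le_cooper_of_le (hab : a ≤ b) (hg : ContDiff ℝ 1 g) {e r η c₀ c₁ L₁ t : ℝ} {N : ℕ} (hη : 0 < η) (hηr : η ≤ r)
    (hc₀ : 0 < c₀) (hc₁ : 0 < c₁) (hL₁ : 0 < L₁) (hL : ∀ x ∈ Icc a b, |deriv g x| ≤ L₁ * r)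
    (hdich : ∀ x ∈ Icc a b, |g x - e| ≤ c₀ * r → c₁ * r ≤ |deriv g x|) (hN : (b - a) * (4 * L₁) * r ≤ N * c₀ * η)
    (he : |e| ≤ c₀ * η / 2) (ht : 0 < t) :
    ∫ x in Icc a b, (max t |g x|)⁻¹ ≤ (4 * (b - a) / c₀ + N * (2 / c₁) * log⁺ (c₀ * η / (4 * t))) / η := by
  -- dichotomy and ceiling at scale `η`, with the ceiling constant `L₁ r/η`
  have hr : 0 < r := hη.trans_le hηr
  have hL' : ∀ x ∈ Icc a b, |deriv g x| ≤ (L₁ * r / η) * η := fun x hx => by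
    rw [div_mul_cancel₀ _ hη.ne']; exact hL x hx
  have hdich' : ∀ x ∈ Icc a b, |g x - e| ≤ c₀ * η → c₁ * η ≤ |deriv g x| := fun x hx hgx => by
    have h1 : c₁ * η ≤ c₁ * r := mul_le_mul_of_nonneg_left hηr hc₁.le
    exact h1.trans (hdich x hx (hgx.trans (mul_le_mul_of_nonneg_left hηr hc₀.le)))
  have hN' : (b - a) * (4 * (L₁ * r / η)) ≤ N * c₀ := by
    rw [show (b - a) * (4 * (L₁ * r / η)) = (b - a) * (4 * L₁) * r / η by ring, div_le_iff₀ hη]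
    exact hN
  exact integral_inv_envelope_le_cooper hab hg hη hc₀ hc₁ (by positivity) hL' hdich' hN' he ht

end Cooper

/-! ## §5 The LEVEL layer: integrating the loop-angle bounds against the finer line's level `e` is `n`-free -/

section Level

variable {lo hi : ℝ}

/-- `log⁺(κ/e) ≤ log⁺(κ/hi) + log(hi/e)` for `0 < e ≤ hi`. -/
theorem posLog_div_le_posLog_div_add_log {κ e : ℝ} (he : 0 < e) (hehi : e ≤ hi) :
    log⁺ (κ / e) ≤ log⁺ (κ / hi) + Real.log (hi / e) := by
  have hhi : 0 < hi := he.trans_le hehi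
  have h1 : κ / e = κ / hi * (hi / e) := by field_simp
  have h1le : 1 ≤ |hi / e| := by
    rw [abs_of_pos (by positivity)]
    exact (one_le_div he).2 hehi
  rw [h1]
  calc log⁺ (κ / hi * (hi / e)) ≤ log⁺ (κ / hi) + log⁺ (hi / e) := Real.posLog_mul
    _ = log⁺ (κ / hi) + Real.log (hi / e) := by rw [Real.posLog_eq_log h1le]

/-- **THE LOGARITHMIC LAYER**: `0 ≤ lo ≤ hi` ⟹ `∫_{lo..hi} log⁺(κ/e) de ≤ (hi − lo)·(1 + log⁺(κ/hi))` — one logarithm of the level is integrable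
(`∫_{lo..hi} log(hi/e) de = hi − lo − lo·log(hi/lo) ≤ hi − lo`, Mathlib `integral_log`). -/
theorem intervalIntegral_posLog_div_le (hlo : 0 ≤ lo) (hlohi : lo ≤ hi) (κ : ℝ) :
    ∫ e in lo..hi, log⁺ (κ / e) ≤ (hi - lo) * (1 + log⁺ (κ / hi)) := by
  rcases eq_or_lt_of_le hlohi with heq | hlt
  · subst heq; simp
  have hhi : 0 < hi := hlo.trans_lt hlt
  -- compare with the integrable majorant `log⁺(κ/hi) + (log hi − log e)` on `(lo, hi]`
  have hmaj : IntervalIntegrable (fun e => log⁺ (κ / hi) + (Real.log hi - Real.log e)) volume lo hi :=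
    (intervalIntegrable_const.add (intervalIntegrable_const.sub intervalIntegral.intervalIntegrable_log'))
  have hle : ∫ e in lo..hi, log⁺ (κ / e) ≤ ∫ e in lo..hi, (log⁺ (κ / hi) + (Real.log hi - Real.log e)) := by
    rw [intervalIntegral.integral_of_le hlohi, intervalIntegral.integral_of_le hlohi]
    refine integral_mono_of_nonneg (Eventually.of_forall fun e => Real.posLog_nonneg) hmaj.1 ?_
    refine (ae_restrict_iff' measurableSet_Ioc).2 (Eventually.of_forall fun e he => ?_)
    have he0 : 0 < e := hlo.trans_lt he.1
    have := posLog_div_le_posLog_div_add_log (κ := κ) he0 he.2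
    rwa [Real.log_div hhi.ne' he0.ne'] at this
  refine hle.trans ?_
  rw [intervalIntegral.integral_add intervalIntegrable_const (intervalIntegrable_const.sub intervalIntegral.intervalIntegrable_log'),
    intervalIntegral.integral_sub intervalIntegrable_const intervalIntegral.intervalIntegrable_log',
    intervalIntegral.integral_const, intervalIntegral.integral_const, integral_log, smul_eq_mul, smul_eq_mul]
  -- `lo·(log hi − log lo) ≥ 0`
  have hlolog : 0 ≤ lo * (Real.log hi - Real.log lo) := by
    rcases eq_or_lt_of_le hlo with h0 | h0
    · rw [← h0]; simp
    · exact mul_nonneg hlo (sub_nonneg.2 (Real.log_le_log h0 hlt.le))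
  nlinarith [Real.posLog_nonneg (x := κ / hi)]

/-- **THE LEVEL LAYER (transversal + fold classes)**: `0 < lo ≤ hi`, a weight `0 ≤ w ≤ W` and loop-angle bounds
`0 ≤ I e ≤ A + B·log⁺(κ/e) + C/√e` on `[lo,hi]` (`A, B, C ≥ 0`) ⟹
`∫_{lo..hi} w e · I e de ≤ W·((A + B·(1 + log⁺(κ/hi)))·(hi − lo) + 2C·√hi)` — NO dependence on `lo` (the infrared end `Λ/2` of the band window): the
absolute bubble is `n`-free.  (If `w·I` is not integrable the Bochner integral is `0` and the bound holds trivially.) [cite: FeldmanSalmhoferTrubowitz1998, §3] -/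
theorem intervalIntegral_level_layer_le (hlo : 0 < lo) (hlohi : lo ≤ hi) {w I : ℝ → ℝ} {W A B C κ : ℝ} (hW : 0 ≤ W) (hA : 0 ≤ A) (hB : 0 ≤ B)
    (hC : 0 ≤ C) (hw0 : ∀ e ∈ Icc lo hi, 0 ≤ w e) (hw : ∀ e ∈ Icc lo hi, w e ≤ W) (hI0 : ∀ e ∈ Icc lo hi, 0 ≤ I e)
    (hI : ∀ e ∈ Icc lo hi, I e ≤ A + B * log⁺ (κ / e) + C * (Real.sqrt e)⁻¹) :
    ∫ e in lo..hi, w e * I e ≤ W * ((A + B * (1 + log⁺ (κ / hi))) * (hi - lo) + 2 * C * Real.sqrt hi) := by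
  have hhi : 0 < hi := hlo.trans_le hlohi
  -- the majorant `W·(A + B log⁺(κ/e) + C/√e)` is continuous on `[lo,hi]`
  have hcont : ContinuousOn (fun e => W * (A + B * log⁺ (κ / e) + C * (Real.sqrt e)⁻¹)) (uIcc lo hi) := by
    rw [uIcc_of_le hlohi]
    refine continuousOn_const.mul ((continuousOn_const.add (continuousOn_const.mul ?_)).add (continuousOn_const.mul ?_))
    · -- `e ↦ log⁺(κ/e)` continuous on `[lo,hi]` (`e ≠ 0`)
      have h1 : ContinuousOn (fun e : ℝ => κ / e) (Icc lo hi) :=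
        continuousOn_const.div continuousOn_id fun e he => (hlo.trans_le he.1).ne'
      exact Real.continuous_posLog.comp_continuousOn h1 |>.congr fun e _ => rfl
    · exact (continuousOn_inv₀.comp Real.continuous_sqrt.continuousOn fun e he => by
        simp only [mem_compl_iff, mem_singleton_iff]; exact (Real.sqrt_pos.2 (hlo.trans_le he.1)).ne')
  have hmaj : IntervalIntegrable (fun e => W * (A + B * log⁺ (κ / e) + C * (Real.sqrt e)⁻¹)) volume lo hi := hcont.intervalIntegrable
  have hle : ∫ e in lo..hi, w e * I e ≤ ∫ e in lo..hi, W * (A + B * log⁺ (κ / e) + C * (Real.sqrt e)⁻¹) := by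
    rw [intervalIntegral.integral_of_le hlohi, intervalIntegral.integral_of_le hlohi]
    refine integral_mono_of_nonneg ?_ hmaj.1 ?_
    · refine (ae_restrict_iff' measurableSet_Ioc).2 (Eventually.of_forall fun e he => ?_)
      exact mul_nonneg (hw0 e ⟨he.1.le, he.2⟩) (hI0 e ⟨he.1.le, he.2⟩)
    · refine (ae_restrict_iff' measurableSet_Ioc).2 (Eventually.of_forall fun e he => ?_)
      have he' : e ∈ Icc lo hi := ⟨he.1.le, he.2⟩
      have h0 : 0 ≤ A + B * log⁺ (κ / e) + C * (Real.sqrt e)⁻¹ := by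
        have := Real.posLog_nonneg (x := κ / e); positivity
      calc w e * I e ≤ W * (A + B * log⁺ (κ / e) + C * (Real.sqrt e)⁻¹) :=
          mul_le_mul (hw e he') (hI e he') (hI0 e he') hW
        _ = _ := rfl
  refine hle.trans ?_
  have hi1 : IntervalIntegrable (fun e => log⁺ (κ / e)) volume lo hi := by
    refine (ContinuousOn.intervalIntegrable ?_)
    rw [uIcc_of_le hlohi]
    exact Real.continuous_posLog.comp_continuousOn (continuousOn_const.div continuousOn_id fun e he => (hlo.trans_le he.1).ne')
  have hi2 : IntervalIntegrable (fun e => (Real.sqrt e)⁻¹) volume lo hi := by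
    refine (ContinuousOn.intervalIntegrable ?_)
    rw [uIcc_of_le hlohi]
    exact (continuousOn_inv₀.comp Real.continuous_sqrt.continuousOn fun e he => by
        simp only [mem_compl_iff, mem_singleton_iff]; exact (Real.sqrt_pos.2 (hlo.trans_le he.1)).ne')
  rw [intervalIntegral.integral_const_mul, intervalIntegral.integral_add (intervalIntegrable_const.add (hi1.const_mul B)) (hi2.const_mul C),
    intervalIntegral.integral_add intervalIntegrable_const (hi1.const_mul B), intervalIntegral.integral_const_mul,
    intervalIntegral.integral_const_mul, intervalIntegral.integral_const, smul_eq_mul, integral_inv_sqrt hlo hlohi]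
  have hlog := intervalIntegral_posLog_div_le hlo.le hlohi κ
  have hsq : 2 * (Real.sqrt hi - Real.sqrt lo) ≤ 2 * Real.sqrt hi := by linarith [Real.sqrt_nonneg lo]
  have hlen : 0 ≤ hi - lo := sub_nonneg.2 hlohi
  refine mul_le_mul_of_nonneg_left ?_ hW
  nlinarith [mul_le_mul_of_nonneg_left hlog hB, mul_le_mul_of_nonneg_left hsq hC, Real.posLog_nonneg (x := κ / hi)]

/-- **THE LEVEL LAYER AT THE COOPER CONFIGURATION**: `0 < lo ≤ hi`, threshold `0 < θ₀` (`= ĉ₀η/2`), weight `0 ≤ w ≤ W`, and loop-angle bounds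
`0 ≤ I e`, `I e ≤ Q + R·log⁺(θ₀/(2e))` for `e ≤ θ₀` (the Cooper lemma, `Q, R ∝ 1/η`) and `I e ≤ P/e` for `θ₀ < e` (the trivial bound) ⟹
`∫_{lo..hi} w e · I e de ≤ W·((Q + 2R)·θ₀ + P·log⁺(hi/θ₀))` — with `Q·θ₀ = 2(b − a)`, `R·θ₀ = N·ĉ₀/ĉ₁` this is `η`-free except for ONE LOGARITHM
`log⁺(2hi/(ĉ₀η))` of the distance to the Cooper configuration, integrable in `ϑ` (`intervalIntegral_posLog_div_le`): the BCS logarithm lives only AT the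
Cooper point.  (No integrability hypothesis: a non-integrable `w·I` has interval integral `0` by convention.) [cite: FeldmanSalmhoferTrubowitz1998, §3] -/
theorem intervalIntegral_level_layer_cooper_le (hlo : 0 < lo) (hlohi : lo ≤ hi) {w I : ℝ → ℝ} {W P Q R θ₀ : ℝ} (hθ₀ : 0 < θ₀) (hW : 0 ≤ W)
    (hP : 0 ≤ P) (hQ : 0 ≤ Q) (hR : 0 ≤ R) (hw0 : ∀ e ∈ Icc lo hi, 0 ≤ w e) (hw : ∀ e ∈ Icc lo hi, w e ≤ W) (hI0 : ∀ e ∈ Icc lo hi, 0 ≤ I e)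
    (hIs : ∀ e ∈ Icc lo hi, e ≤ θ₀ → I e ≤ Q + R * log⁺ (θ₀ / (2 * e))) (hIl : ∀ e ∈ Icc lo hi, θ₀ < e → I e ≤ P / e) :
    ∫ e in lo..hi, w e * I e ≤ W * ((Q + 2 * R) * θ₀ + P * log⁺ (hi / θ₀)) := by
  have hhi : 0 < hi := hlo.trans_le hlohi
  -- if `w·I` is not integrable the interval integral is `0` by convention and the bound is trivial
  by_cases hint : IntervalIntegrable (fun e => w e * I e) volume lo hi
  swap
  · rw [intervalIntegral.integral_undef hint]
    exact mul_nonneg hW (add_nonneg (by positivity) (mul_nonneg hP Real.posLog_nonneg))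
  -- split point `m = max lo (min θ₀ hi) ∈ [lo, hi]`
  set m : ℝ := max lo (min θ₀ hi) with hm
  have hlom : lo ≤ m := le_max_left _ _
  have hmhi : m ≤ hi := max_le hlohi (min_le_right _ _)
  have hm0 : 0 < m := hlo.trans_le hlom
  have hi1 : IntervalIntegrable (fun e => w e * I e) volume lo m :=
    hint.mono_set (by rw [uIcc_of_le hlohi, uIcc_of_le hlom]; exact Icc_subset_Icc le_rfl hmhi)
  have hi2 : IntervalIntegrable (fun e => w e * I e) volume m hi :=
    hint.mono_set (by rw [uIcc_of_le hlohi, uIcc_of_le hmhi]; exact Icc_subset_Icc hlom le_rfl)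
  rw [← intervalIntegral.integral_add_adjacent_intervals hi1 hi2]
  -- small levels `[lo, m]`: here `e ≤ θ₀` (if `lo < m` then `m = min θ₀ hi ≤ θ₀`)
  have hsmall : ∫ e in lo..m, w e * I e ≤ W * ((Q + 2 * R) * θ₀) := by
    rcases eq_or_lt_of_le hlom with heq | hlt
    · rw [← heq, intervalIntegral.integral_same]; positivity
    have hmθ : m ≤ θ₀ := by
      have hlox : lo ≤ min θ₀ hi := by
        have h := hlt
        rw [hm, lt_max_iff] at h
        rcases h with h | h
        · exact absurd h (lt_irrefl _)
        · exact h.le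
      have : m = min θ₀ hi := by rw [hm, max_eq_right hlox]
      rw [this]; exact min_le_left _ _
    have h1 : ∫ e in lo..m, w e * I e ≤ W * ((Q + R * (1 + log⁺ (θ₀ / 2 / m))) * (m - lo) + 2 * 0 * Real.sqrt m) := by
      refine intervalIntegral_level_layer_le hlo hlom hW hQ hR le_rfl
        (fun e he => hw0 e ⟨he.1, he.2.trans hmhi⟩) (fun e he => hw e ⟨he.1, he.2.trans hmhi⟩)
        (fun e he => hI0 e ⟨he.1, he.2.trans hmhi⟩) fun e he => ?_
      have := hIs e ⟨he.1, he.2.trans hmhi⟩ (he.2.trans hmθ)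
      rw [zero_mul, add_zero, div_div]
      exact this
    refine h1.trans (mul_le_mul_of_nonneg_left ?_ hW)
    rw [mul_zero, zero_mul, add_zero]
    -- `log⁺(θ₀/(2m)) ≤ log⁺(θ₀/(2lo))`… we only need `(Q + R(1 + log⁺(θ₀/2/m)))(m − lo) ≤ (Q+R)θ₀`; use `log⁺ x ≤ x`-free route:
    -- `log⁺(θ₀/2/m)·(m − lo) ≤ (θ₀/2/m)·m = θ₀/2` via `log⁺ y ≤ y` for `y ≥ 0`, and `m − lo ≤ m ≤ θ₀`.
    have hy : 0 ≤ θ₀ / 2 / m := by positivity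
    have hlogle : log⁺ (θ₀ / 2 / m) ≤ θ₀ / 2 / m := by
      rw [Real.posLog_apply]
      refine max_le hy ?_
      exact (Real.log_le_sub_one_of_pos (by positivity)).trans (by linarith)
    have hml : m - lo ≤ m := by linarith
    have hml0 : 0 ≤ m - lo := sub_nonneg.2 hlom
    have key : log⁺ (θ₀ / 2 / m) * (m - lo) ≤ θ₀ / 2 := by
      calc log⁺ (θ₀ / 2 / m) * (m - lo) ≤ (θ₀ / 2 / m) * m := mul_le_mul hlogle hml hml0 hy
        _ = θ₀ / 2 := by field_simp
    have e1 : (Q + R * (1 + log⁺ (θ₀ / 2 / m))) * (m - lo) = Q * (m - lo) + R * (m - lo) + R * (log⁺ (θ₀ / 2 / m) * (m - lo)) := by ring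
    have h1' := mul_le_mul_of_nonneg_left (hml.trans hmθ) hQ
    have h2' := mul_le_mul_of_nonneg_left (hml.trans hmθ) hR
    have h3' : R * (log⁺ (θ₀ / 2 / m) * (m - lo)) ≤ R * θ₀ := mul_le_mul_of_nonneg_left (key.trans (by linarith)) hR
    rw [e1]
    nlinarith
  -- large levels `[m, hi]`: here `θ₀ < e` unless the piece is trivial
  have hlarge : ∫ e in m..hi, w e * I e ≤ W * (P * log⁺ (hi / θ₀)) := by
    rcases eq_or_lt_of_le hmhi with heq | hlt
    · rw [heq, intervalIntegral.integral_same]; exact mul_nonneg hW (mul_nonneg hP Real.posLog_nonneg)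
    -- `m < hi` forces `θ₀ ≤ m` (else `m = max lo θ₀ ≥ θ₀`… precisely: `min θ₀ hi ≤ m`, and `m < hi` ⇒ `min θ₀ hi = θ₀` or `lo ≥ …`)
    have hθm : θ₀ ≤ m := by
      by_contra hcon
      push Not at hcon
      have : min θ₀ hi ≤ m := le_max_right _ _
      rcases le_total θ₀ hi with h | h
      · rw [min_eq_left h] at this; exact absurd this (not_le.2 hcon)
      · have : hi ≤ m := by rw [min_eq_right h] at this; exact this
        exact absurd hlt (not_lt.2 this)
    have hmaj : IntervalIntegrable (fun e => W * (P * e⁻¹)) volume m hi := by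
      refine (ContinuousOn.intervalIntegrable ?_)
      rw [uIcc_of_le hmhi]
      exact continuousOn_const.mul (continuousOn_const.mul (continuousOn_inv₀.mono fun e he => (hm0.trans_le he.1).ne'))
    have hle : ∫ e in m..hi, w e * I e ≤ ∫ e in m..hi, W * (P * e⁻¹) := by
      rw [intervalIntegral.integral_of_le hmhi, intervalIntegral.integral_of_le hmhi]
      refine integral_mono_of_nonneg ?_ hmaj.1 ?_
      · refine (ae_restrict_iff' measurableSet_Ioc).2 (Eventually.of_forall fun e he => ?_)
        exact mul_nonneg (hw0 e ⟨hlom.trans he.1.le, he.2⟩) (hI0 e ⟨hlom.trans he.1.le, he.2⟩)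
      · refine (ae_restrict_iff' measurableSet_Ioc).2 (Eventually.of_forall fun e he => ?_)
        have he' : e ∈ Icc lo hi := ⟨hlom.trans he.1.le, he.2⟩
        have he0 : 0 < e := hm0.trans he.1
        calc w e * I e ≤ W * (P / e) := mul_le_mul (hw e he') (hIl e he' (hθm.trans_lt he.1)) (hI0 e he') hW
          _ = W * (P * e⁻¹) := by rw [div_eq_mul_inv]
    refine hle.trans ?_
    rw [intervalIntegral.integral_const_mul, intervalIntegral.integral_const_mul, integral_inv_of_pos hm0 hhi]
    refine mul_le_mul_of_nonneg_left (mul_le_mul_of_nonneg_left ?_ hP) hW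
    calc Real.log (hi / m) ≤ Real.log (hi / θ₀) := Real.log_le_log (by positivity) (div_le_div_of_nonneg_left hhi.le hθ₀ hθm)
      _ ≤ log⁺ (hi / θ₀) := by rw [Real.posLog_apply]; exact le_max_right _ _
  calc (∫ e in lo..m, w e * I e) + ∫ e in m..hi, w e * I e ≤ W * ((Q + 2 * R) * θ₀) + W * (P * log⁺ (hi / θ₀)) := add_le_add hsmall hlarge
    _ = W * ((Q + 2 * R) * θ₀ + P * log⁺ (hi / θ₀)) := by ring

end Level

end Summit.HubbardSuperconductivity.HubbardSuperconductivity.Theorems.C4a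

end
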